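import Literature.NumberTheory.Automorphic.UnitaryGroupTruncatedTraceClassDifferenceUnfolding
import Literature.NumberTheory.Automorphic.UnitaryGroupTruncatedKernelClassDifferenceTwo
import Literature.NumberTheory.Automorphic.UnitaryGroupBorelCosetSumUnfoldingTwo
import HarnessLib

/-!
# `J^{T'}_𝔬(f) − J^{T}_𝔬(f)` on `U(J₂)` unfolded to the group, class by class: the four nonnegative parts of the class
# window `1_{T<H≤T'} K_{B,𝔬}` integrated against a covering weight of `B(F)` (the per-class Bochner ⇄ lintegral bridge
# in two variables)
(Rogawski, *Automorphic Representations of Unitary Groups in Three Variables* (1990), §2.2 p. 13 and §2.3 p. 14, for the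
rank-one groups `U(3)`, `U(2)`, `U(2) × U(1)` of §7.3 p. 98; Arthur, *The trace formula in invariant form*, Ann. of Math.
114 (1981), Prop. 2.3 — stated class by class; Gelbart, *Automorphic forms on adele groups* (1975), §9.B (9.40)–(9.48).)

Topic `NumberTheory/Automorphic`; namespace `Literature.NumberTheory.Automorphic.UnitaryGroup`. THEOREMS ONLY over
accepted tree modules: no definition, no named fact, no `sorry`, no instance, no notation. The `N = 2` sibling of ★
`UnitaryGroupTruncatedTraceClassDifferenceUnfolding` (class copy) together with the two class-agnostic collapse lemmas
of the total ★ `UnitaryGroupTruncatedTraceDifferenceUnfolding` §1 — the TOTAL difference unfolding is not retyped at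
`N = 2` (census Q5 «class rows first»). Inputs at `N = 2`: the Siegel property ★
`not_lt_borelHeight_mul_of_not_mem_arithmeticBorel_two`, the class window identity ★
`truncatedKernelClass_sub_truncatedKernelClass_two` (`UnitaryGroupTruncatedKernelClassDifferenceTwo`) and Weil's unfolding
★ `exists_ne_zero_lintegral_tsum_borelQuotient_eq_mul_lintegral_two` (`UnitaryGroupBorelCosetSumUnfoldingTwo`). H-SIDE
copy of LAWS 1–5 (`H = U(Φ₂) × U(Φ₁)`; LEAD WORDs #123∕#124; census `CENSUS-LAWS-Hside.F0P3a-p03g6.md` §3 LAW 2∕LAW 3)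
of the T1 line `Cruxes/H413/Lines/F0_T1InnerFormTraceIdentity.lean` (cell `pub/hodgecm-mathlib`, crux H413).

* §1 `tsum_borelQuotient_eq_of_lt_two`, `tsum_borelQuotient_eq_zero_two` — the collapse of a coset sum of a
  left-`B(F)`-invariant `ψ ≥ 0` supported above the threshold;
* §2 `ofReal_comp_pseudoEisenstein_classWindow_eq_tsum_two` — pointwise, the clipped parts of the class window's
  pseudo-Eisenstein series are the coset sums of the clipped parts;
* §3 **`exists_truncatedTraceClass_sub_eq_parts_two`** (and the fixed-class form `exists_truncatedTraceClass_sub_eq_parts_two'`)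
  — `J^{T'}_𝔬(f) − J^{T}_𝔬(f) = [(C ∫⁻ β w₁).toReal − (C ∫⁻ β w₂).toReal] + i [(C ∫⁻ β w₃).toReal − (C ∫⁻ β w₄).toReal]`
  with ONE constant `C ≠ ∞` for all classes and windows, each `∫⁻ β w_j` finite.

## References

* J. D. Rogawski, *Automorphic Representations of Unitary Groups in Three Variables*, Ann. of Math. Stud. 123 (1990),
  §2.2 (p. 13), §2.3 (p. 14), §7.3 (p. 98) [Rogawski1990].
* J. Arthur, *The trace formula in invariant form*, Ann. of Math. 114 (1981), Prop. 2.3 [Arthur1981TraceFormulaInvariantForm].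
* S. Gelbart, *Automorphic forms on adele groups*, Ann. of Math. Stud. 83 (1975), §9.B [Gelbart1975].
-/

set_option autoImplicit false

noncomputable section

open MeasureTheory Measure NumberField IsDedekindDomain Set
open Literature.MeasureTheory.Group
open scoped NNReal ENNReal Pointwise

namespace Literature.NumberTheory.Automorphic

namespace UnitaryGroup

variable {F E : Type} [Field F] [NumberField F] [Field E] [NumberField E] [Algebra F E]
  {c : E ≃ₐ[F] E} {ι : Type*}

/-! ## §1 The collapse of a coset sum above the Siegel threshold -/

/-- On the fibre of `q ∈ B(F)\G(F)` a left-`B(F)`-invariant `ψ` is constant: `ψ(q̃ y) = ψ(γ y)` for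
`B(F) γ = q`. [folklore] -/
private theorem apply_out_mk_mul₂ {ψ : (quasiSplit F E c 2).Adelic → ℝ≥0∞}
    (hψ : ∀ b ∈ arithmeticBorel F E c 2, ∀ y : (quasiSplit F E c 2).Adelic,
      ψ ((b : (quasiSplit F E c 2).Adelic) * y) = ψ y)
    (γ : (quasiSplit F E c 2).arithmeticSubgroup) (y : (quasiSplit F E c 2).Adelic) :
    ψ ((((Quotient.mk (QuotientGroup.rightRel (arithmeticBorel F E c 2)) γ).out :
        (quasiSplit F E c 2).arithmeticSubgroup) : (quasiSplit F E c 2).Adelic) * y) =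
      ψ ((γ : (quasiSplit F E c 2).Adelic) * y) := by
  set δ := (Quotient.mk (QuotientGroup.rightRel (arithmeticBorel F E c 2)) γ).out with hδ
  have hrel : γ * δ⁻¹ ∈ arithmeticBorel F E c 2 := by
    have h : @Setoid.r _ (QuotientGroup.rightRel (arithmeticBorel F E c 2)) δ γ :=
      Quotient.mk_out (s := QuotientGroup.rightRel (arithmeticBorel F E c 2)) γ
    exact QuotientGroup.rightRel_apply.1 h
  have hδγ : (δ : (quasiSplit F E c 2).Adelic) =
      ((γ * δ⁻¹)⁻¹ : (quasiSplit F E c 2).arithmeticSubgroup) * (γ : (quasiSplit F E c 2).Adelic) := by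
    push_cast
    group
  rw [hδγ, mul_assoc, hψ _ (Subgroup.inv_mem _ hrel)]

/-- **THE COLLAPSE ABOVE THE THRESHOLD.** Let `ψ ≥ 0` on `U(J₂)(𝔸_F)` be left-`B(F)`-invariant and vanish
off `{T < H}`, `1 ≤ T`. If `T < H(γ y)` for some `γ ∈ G(F)`, then `Σ'_{q ∈ B(F)\G(F)} ψ(q̃ y) = ψ(γ y)`: by the
Siegel property ★ `not_lt_borelHeight_mul_of_not_mem_arithmeticBorel_two` no class other than `B(F) γ` is above
`T` at `y`. [cite: Rogawski1990, §2.2 (p. 13)] -/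
theorem tsum_borelQuotient_eq_of_lt_two {ψ : (quasiSplit F E c 2).Adelic → ℝ≥0∞}
    (hψ : ∀ b ∈ arithmeticBorel F E c 2, ∀ y : (quasiSplit F E c 2).Adelic,
      ψ ((b : (quasiSplit F E c 2).Adelic) * y) = ψ y)
    {T : ℝ≥0} (hT : 1 ≤ T)
    (hψT : ∀ z : (quasiSplit F E c 2).Adelic, ¬T < borelHeight z → ψ z = 0)
    {y : (quasiSplit F E c 2).Adelic} {γ : (quasiSplit F E c 2).arithmeticSubgroup}
    (hγ : T < borelHeight ((γ : (quasiSplit F E c 2).Adelic) * y)) :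
    ∑' q : Quotient (QuotientGroup.rightRel (arithmeticBorel F E c 2)),
        ψ (((q.out : (quasiSplit F E c 2).arithmeticSubgroup) : (quasiSplit F E c 2).Adelic) * y) =
      ψ ((γ : (quasiSplit F E c 2).Adelic) * y) := by
  classical
  rw [tsum_eq_single (Quotient.mk (QuotientGroup.rightRel (arithmeticBorel F E c 2)) γ)]
  · exact apply_out_mk_mul₂ hψ γ y
  · intro q hq
    -- `q̃ γ⁻¹ ∉ B(F)`, so `q̃ y = (q̃ γ⁻¹)(γ y)` is not above `T`
    have hnot : q.out * γ⁻¹ ∉ arithmeticBorel F E c 2 := by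
      intro hmem
      apply hq
      rw [← Quotient.out_eq q]
      refine (Quotient.sound ?_).symm
      change @Setoid.r _ (QuotientGroup.rightRel (arithmeticBorel F E c 2)) γ q.out
      rw [QuotientGroup.rightRel_apply]
      exact hmem
    have hlt := not_lt_borelHeight_mul_of_not_mem_arithmeticBorel_two hnot hT hγ
    have heq : ((q.out * γ⁻¹ : (quasiSplit F E c 2).arithmeticSubgroup) : (quasiSplit F E c 2).Adelic) *
        ((γ : (quasiSplit F E c 2).Adelic) * y) =
        ((q.out : (quasiSplit F E c 2).arithmeticSubgroup) : (quasiSplit F E c 2).Adelic) * y := by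
      push_cast
      group
    rw [heq] at hlt
    exact hψT _ hlt

/-- **THE COLLAPSE BELOW THE THRESHOLD.** If `ψ ≥ 0` vanishes off `{T < H}` and no `γ y`, `γ ∈ G(F)`, is
above `T`, then `Σ'_{q ∈ B(F)\G(F)} ψ(q̃ y) = 0`. [cite: Rogawski1990, §2.2 (p. 13)] -/
theorem tsum_borelQuotient_eq_zero_two {ψ : (quasiSplit F E c 2).Adelic → ℝ≥0∞} {T : ℝ≥0}
    (hψT : ∀ z : (quasiSplit F E c 2).Adelic, ¬T < borelHeight z → ψ z = 0)
    {y : (quasiSplit F E c 2).Adelic}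
    (hy : ∀ γ : (quasiSplit F E c 2).arithmeticSubgroup,
      borelHeight ((γ : (quasiSplit F E c 2).Adelic) * y) ≤ T) :
    ∑' q : Quotient (QuotientGroup.rightRel (arithmeticBorel F E c 2)),
        ψ (((q.out : (quasiSplit F E c 2).arithmeticSubgroup) : (quasiSplit F E c 2).Adelic) * y) = 0 :=
  ENNReal.tsum_eq_zero.2 fun q => hψT _ (not_lt.2 (hy q.out))

/-! ## §2 The four parts of the class window and their coset sums -/

section Window

variable [MeasurableSpace (adelicUnipotent F E c 2)]

/-- **POINTWISE, CLASS BY CLASS: the clipped real∕imaginary parts of the class window's pseudo-Eisenstein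
series are the coset sums of the clipped parts of the class window.** For `1 ≤ T ≤ T'`, every `y`, every
map `φ : ℂ → ℝ` with `φ 0 = 0` (meant: `φ ∈ {re, −re, im, −im}`), and every class map `cl`, index `i`, granted
the left `B(F)`-invariance `hK` of the diagonal of `K_{B,𝔬}` (★ `kernelBorelClass_diag_rational_borel_mul`):
`ofReal (φ (pseudoEisenstein window_𝔬 y)) = Σ'_{q ∈ B(F)\G(F)} ofReal (φ (window_𝔬 (q̃ y)))` — above the
threshold both sides are the value at the unique class of `B(F)\G(F)` above `T` (★
`pseudoEisenstein_classWindow_eq_self_two`, ★ `tsum_borelQuotient_eq_of_lt_two`), below it both vanish (★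
`pseudoEisenstein_classWindow_eq_zero_two`, ★ `tsum_borelQuotient_eq_zero_two`). Every `ν`, every `𝓕`. The class
analogue of ★ `ofReal_comp_pseudoEisenstein_window_eq_tsum`. [cite: Rogawski1990, §2.2 (p. 13)] -/
theorem ofReal_comp_pseudoEisenstein_classWindow_eq_tsum_two {ν : Measure (adelicUnipotent F E c 2)}
    {𝓕 : Set (adelicUnipotent F E c 2)} {cl : (quasiSplit F E c 2).arithmeticSubgroup → ι} {i : ι}
    {f : (quasiSplit F E c 2).Adelic → ℂ}
    (hK : ∀ b ∈ arithmeticBorel F E c 2, ∀ y : (quasiSplit F E c 2).Adelic,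
      kernelBorelClass ν 𝓕 cl i f ((b : (quasiSplit F E c 2).Adelic) * y)
        ((b : (quasiSplit F E c 2).Adelic) * y) = kernelBorelClass ν 𝓕 cl i f y y)
    {T T' : ℝ≥0} (hT : 1 ≤ T) (hTT' : T ≤ T')
    (φ : ℂ → ℝ) (hφ : φ 0 = 0) (y : (quasiSplit F E c 2).Adelic) :
    ENNReal.ofReal (φ (pseudoEisenstein
        ({y : (quasiSplit F E c 2).Adelic | T < borelHeight y ∧ borelHeight y ≤ T'}.indicator
          (fun y => kernelBorelClass ν 𝓕 cl i f y y)) y)) =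
      ∑' q : Quotient (QuotientGroup.rightRel (arithmeticBorel F E c 2)),
        ENNReal.ofReal (φ ({y : (quasiSplit F E c 2).Adelic | T < borelHeight y ∧ borelHeight y ≤ T'}.indicator
          (fun y => kernelBorelClass ν 𝓕 cl i f y y)
            (((q.out : (quasiSplit F E c 2).arithmeticSubgroup) : (quasiSplit F E c 2).Adelic) * y))) := by
  set W : (quasiSplit F E c 2).Adelic → ℂ :=
    {y : (quasiSplit F E c 2).Adelic | T < borelHeight y ∧ borelHeight y ≤ T'}.indicator
      (fun y => kernelBorelClass ν 𝓕 cl i f y y) with hW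
  -- the part `ψ = ofReal ∘ φ ∘ W` is left-`B(F)`-invariant and vanishes off `{T < H}`
  have hψB : ∀ b ∈ arithmeticBorel F E c 2, ∀ z : (quasiSplit F E c 2).Adelic,
      ENNReal.ofReal (φ (W ((b : (quasiSplit F E c 2).Adelic) * z))) = ENNReal.ofReal (φ (W z)) := by
    intro b hb z
    rw [hW, classWindow_rational_borel_mul hK hTT' b hb z]
  have hψT : ∀ z : (quasiSplit F E c 2).Adelic, ¬T < borelHeight z → ENNReal.ofReal (φ (W z)) = 0 := by
    intro z hz
    rw [hW, classWindow_of_not_lt ν 𝓕 cl i f hz, hφ, ENNReal.ofReal_zero]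
  by_cases h : ∃ γ : (quasiSplit F E c 2).arithmeticSubgroup,
      T < borelHeight ((γ : (quasiSplit F E c 2).Adelic) * y)
  · obtain ⟨γ, hγ⟩ := h
    rw [tsum_borelQuotient_eq_of_lt_two hψB hT hψT hγ, hW,
      ← pseudoEisenstein_classWindow_rational_mul_two hK hTT' γ y,
      pseudoEisenstein_classWindow_eq_self_two hK hT hTT' hγ]
  · simp only [not_exists, not_lt] at h
    rw [tsum_borelQuotient_eq_zero_two hψT h, hW, pseudoEisenstein_classWindow_eq_zero_two ν 𝓕 cl i f h, hφ,
      ENNReal.ofReal_zero]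

end Window

/-! ## §3 The bridge, class by class -/

section Bridge

variable [MeasurableSpace (adelicUnipotent F E c 2)] [BorelSpace (adelicUnipotent F E c 2)]
  [MeasurableSpace (quasiSplit F E c 2).Adelic] [BorelSpace (quasiSplit F E c 2).Adelic]

/-- **`J^{T'}_𝔬(f) − J^{T}_𝔬(f)` AS FOUR UNFOLDED NONNEGATIVE INTEGRALS, WITH ONE CONSTANT FOR ALL CLASSES AND
ALL WINDOWS.** For a Haar measure `ν` of `N(𝔸_F)`, a fundamental domain `𝓕` of `N(F)`, an automorphic measure `μ`
on `G(F)\G(𝔸_F)`, an inversion-invariant Haar measure `ν_G` of `G(𝔸_F) = U(J₂)(𝔸_F)`, a continuous `f` (no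
support condition is needed here), a class map `cl` satisfying Rogawski's two partition axioms (`hcl : IsConjInvariant cl`,
`hclN : IsUnipotentInvariantOnBorel F E c 2 cl` — e.g. the characteristic-polynomial class map, ★
`isConjInvariant_charpoly_adelicVal`, ★ `isUnipotentInvariantOnBorel_charpoly_adelicVal`) and a covering weight
`β` of `B(F)♯`, there is ONE constant `C ≠ ∞` (Weil's unfolding constant of ★
`exists_ne_zero_lintegral_tsum_borelQuotient_eq_mul_lintegral_two`, independent of the class) such that for every
index `i` and all `1 ≤ T ≤ T'` at which `k^T_𝔬` and `k^{T'}_𝔬` are integrable over `G(F)\G(𝔸_F)`: the four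
integrals `∫⁻_{G(𝔸)} β w_j dν_G` of the parts `w₁ = (Re window_𝔬)⁺, w₂ = (Re window_𝔬)⁻, w₃ = (Im window_𝔬)⁺,
w₄ = (Im window_𝔬)⁻` of the class window `window_𝔬(y) = 1_{T<H(y)≤T'} K_{B,𝔬}(y, y)` are finite, and
`J^{T'}_𝔬(f) − J^{T}_𝔬(f) = [(C∫⁻βw₁).toReal − (C∫⁻βw₂).toReal] + i[(C∫⁻βw₃).toReal − (C∫⁻βw₄).toReal]`
(`D = quotFun k^{T'}_𝔬 − quotFun k^{T}_𝔬` is `μ`-integrable; `∫ D = ∫ Re D + i ∫ Im D`; positive and negative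
parts; `quotFun` is evaluation at `x̃⁻¹`; ★ `truncatedKernelClass_sub_truncatedKernelClass_two` with `hK` := ★
`kernelBorelClass_diag_rational_borel_mul hcl hclN`; §1; ★ L2-u with `C ≠ 0`). The class analogue of ★
`exists_truncatedTrace_sub_eq_parts` (Arthur (1981), Prop. 2.3, is stated class by class; Rogawski (1990), §2.3).
[cite: Rogawski1990, §2.3 (p. 14)] [cite: Arthur1981TraceFormulaInvariantForm, Prop. 2.3] -/
theorem exists_truncatedTraceClass_sub_eq_parts_two (ν : Measure (adelicUnipotent F E c 2)) [ν.IsHaarMeasure]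
    {𝓕 : Set (adelicUnipotent F E c 2)} (h𝓕 : IsFundamentalDomain (rationalUnipotent F E c 2) 𝓕 ν)
    (μ : Measure (quasiSplit F E c 2).automorphicQuotient) [(quasiSplit F E c 2).IsAutomorphicMeasure μ]
    (νG : Measure (quasiSplit F E c 2).Adelic) [νG.IsHaarMeasure] [νG.IsInvInvariant]
    (f : (quasiSplit F E c 2).Adelic → ℂ) (hfc : Continuous f)
    {cl : (quasiSplit F E c 2).arithmeticSubgroup → ι}
    (hcl : IsConjInvariant cl) (hclN : IsUnipotentInvariantOnBorel F E c 2 cl)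
    {β : (quasiSplit F E c 2).Adelic → ℝ≥0∞}
    (hβ : IsCoveringWeight ((arithmeticBorel F E c 2).map (quasiSplit F E c 2).arithmeticSubgroup.subtype) β) :
    ∃ C : ℝ≥0∞, C ≠ ⊤ ∧ ∀ (i : ι) (T T' : ℝ≥0), 1 ≤ T → T ≤ T' →
      Integrable ((quasiSplit F E c 2).quotFun (truncatedKernelClass ν 𝓕 T cl i f)) μ →
      Integrable ((quasiSplit F E c 2).quotFun (truncatedKernelClass ν 𝓕 T' cl i f)) μ →
      (∫⁻ y, β y * ENNReal.ofReal
          ({y : (quasiSplit F E c 2).Adelic | T < borelHeight y ∧ borelHeight y ≤ T'}.indicator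
            (fun y => kernelBorelClass ν 𝓕 cl i f y y) y).re ∂νG ≠ ⊤ ∧
       ∫⁻ y, β y * ENNReal.ofReal
          (-({y : (quasiSplit F E c 2).Adelic | T < borelHeight y ∧ borelHeight y ≤ T'}.indicator
            (fun y => kernelBorelClass ν 𝓕 cl i f y y) y).re) ∂νG ≠ ⊤ ∧
       ∫⁻ y, β y * ENNReal.ofReal
          ({y : (quasiSplit F E c 2).Adelic | T < borelHeight y ∧ borelHeight y ≤ T'}.indicator
            (fun y => kernelBorelClass ν 𝓕 cl i f y y) y).im ∂νG ≠ ⊤ ∧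
       ∫⁻ y, β y * ENNReal.ofReal
          (-({y : (quasiSplit F E c 2).Adelic | T < borelHeight y ∧ borelHeight y ≤ T'}.indicator
            (fun y => kernelBorelClass ν 𝓕 cl i f y y) y).im) ∂νG ≠ ⊤) ∧
      truncatedTraceClass μ ν 𝓕 T' cl i f - truncatedTraceClass μ ν 𝓕 T cl i f =
        (((C * ∫⁻ y, β y * ENNReal.ofReal
            ({y : (quasiSplit F E c 2).Adelic | T < borelHeight y ∧ borelHeight y ≤ T'}.indicator
              (fun y => kernelBorelClass ν 𝓕 cl i f y y) y).re ∂νG).toReal -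
          (C * ∫⁻ y, β y * ENNReal.ofReal
            (-({y : (quasiSplit F E c 2).Adelic | T < borelHeight y ∧ borelHeight y ≤ T'}.indicator
              (fun y => kernelBorelClass ν 𝓕 cl i f y y) y).re) ∂νG).toReal : ℝ) : ℂ) +
        (((C * ∫⁻ y, β y * ENNReal.ofReal
            ({y : (quasiSplit F E c 2).Adelic | T < borelHeight y ∧ borelHeight y ≤ T'}.indicator
              (fun y => kernelBorelClass ν 𝓕 cl i f y y) y).im ∂νG).toReal -
          (C * ∫⁻ y, β y * ENNReal.ofReal
            (-({y : (quasiSplit F E c 2).Adelic | T < borelHeight y ∧ borelHeight y ≤ T'}.indicator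
              (fun y => kernelBorelClass ν 𝓕 cl i f y y) y).im) ∂νG).toReal : ℝ) : ℂ) * Complex.I := by
  classical
  -- `N(𝔸_F)` closed ⇒ second countable, locally compact; `ν` s-finite (for measurability of `K_B`)
  haveI := secondCountableTopology_adeleRing E
  haveI := locallyCompactSpace_adeleRing' E
  haveI := t2Space_adeleRing_of_numberField E
  haveI : T2Space (quasiSplit F E c 2).Adelic :=
    inferInstanceAs (T2Space (adelic F E c 2 ((StdForm.antidiagonal 2).over E)))
  haveI : LocallyCompactSpace (quasiSplit F E c 2).Adelic :=
    inferInstanceAs (LocallyCompactSpace (adelic F E c 2 ((StdForm.antidiagonal 2).over E)))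
  haveI : SecondCountableTopology (quasiSplit F E c 2).Adelic :=
    inferInstanceAs (SecondCountableTopology (adelic F E c 2 ((StdForm.antidiagonal 2).over E)))
  have hNcl : IsClosed ((adelicUnipotent F E c 2 : Set (quasiSplit F E c 2).Adelic)) := by
    change IsClosed (⇑(adelicVal F E c 2 ((StdForm.antidiagonal 2).over E)) ⁻¹'
      ((upperUnitriangular (Fin 2) (AdeleRing (𝓞 E) E) : Subgroup (GL (Fin 2) (AdeleRing (𝓞 E) E))) :
        Set (GL (Fin 2) (AdeleRing (𝓞 E) E))))
    exact (isClosed_upperUnitriangular (R := AdeleRing (𝓞 E) E)).preimage continuous_subtype_val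
  haveI : SecondCountableTopology (adelicUnipotent F E c 2) := TopologicalSpace.Subtype.secondCountableTopology _
  haveI : LocallyCompactSpace (adelicUnipotent F E c 2) := hNcl.locallyCompactSpace
  haveI : SFinite ν := inferInstance
  -- the unfolding constant `C ≠ 0, ≠ ∞` of ★ L2-u
  obtain ⟨C, hC0, hCtop, hunf⟩ :=
    exists_ne_zero_lintegral_tsum_borelQuotient_eq_mul_lintegral_two (F := F) (E := E) (c := c) μ νG
  refine ⟨C, hCtop, fun i T T' hT hTT' hint hint' => ?_⟩
  -- the `B(F)`-invariance of the diagonal of `K_{B,𝔬}` (Rogawski's two partition axioms)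
  have hK : ∀ b ∈ arithmeticBorel F E c 2, ∀ y : (quasiSplit F E c 2).Adelic,
      kernelBorelClass ν 𝓕 cl i f ((b : (quasiSplit F E c 2).Adelic) * y)
        ((b : (quasiSplit F E c 2).Adelic) * y) = kernelBorelClass ν 𝓕 cl i f y y :=
    fun b hb y => kernelBorelClass_diag_rational_borel_mul hcl hclN ν h𝓕 i f b hb y
  -- the window and its measurability
  set W : (quasiSplit F E c 2).Adelic → ℂ :=
    {y : (quasiSplit F E c 2).Adelic | T < borelHeight y ∧ borelHeight y ≤ T'}.indicator
      (fun y => kernelBorelClass ν 𝓕 cl i f y y) with hW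
  have hWm : Measurable W := by
    refine (measurable_kernelBorelClass_diag hfc ν 𝓕 cl i).indicator ?_
    have h1 := measurableSet_setOf_lt_borelHeight (F := F) (E := E) (c := c) (N := 2) T
    have h2 := measurableSet_setOf_lt_borelHeight (F := F) (E := E) (c := c) (N := 2) T'
    have hset : {y : (quasiSplit F E c 2).Adelic | T < borelHeight y ∧ borelHeight y ≤ T'} =
        {y : (quasiSplit F E c 2).Adelic | T < borelHeight y} \ {y | T' < borelHeight y} := by
      ext y
      simp only [Set.mem_setOf_eq, Set.mem_sdiff, not_lt]
    rw [hset]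
    exact h1.diff h2
  -- the four parts `ψφ = ofReal ∘ φ ∘ W`, `φ ∈ {re, −re, im, −im}`: measurable and `B(F)`-invariant
  have hpart : ∀ φ : ℂ → ℝ, Measurable φ → φ 0 = 0 →
      Measurable (fun y => ENNReal.ofReal (φ (W y))) ∧
      (∀ b ∈ arithmeticBorel F E c 2, ∀ z : (quasiSplit F E c 2).Adelic,
        ENNReal.ofReal (φ (W ((b : (quasiSplit F E c 2).Adelic) * z))) = ENNReal.ofReal (φ (W z))) := by
    intro φ hφm hφ0
    refine ⟨ENNReal.measurable_ofReal.comp (hφm.comp hWm), fun b hb z => ?_⟩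
    rw [hW, classWindow_rational_borel_mul hK hTT' b hb z]
  -- the unfolded identity for one part: `∫⁻_X ofReal (φ (D x)) dμ = C ∫⁻ β ψφ`, where `D(x) = Ψ_W(x̃⁻¹)`
  set D : (quasiSplit F E c 2).automorphicQuotient → ℂ := fun x =>
    (quasiSplit F E c 2).quotFun (truncatedKernelClass ν 𝓕 T' cl i f) x -
      (quasiSplit F E c 2).quotFun (truncatedKernelClass ν 𝓕 T cl i f) x with hD
  have hDW : ∀ x : (quasiSplit F E c 2).automorphicQuotient,
      D x = pseudoEisenstein W ((Quotient.out x : (quasiSplit F E c 2).Adelic)⁻¹) := fun x =>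
    truncatedKernelClass_sub_truncatedKernelClass_two hcl hK hT hTT' _
  have hDint : Integrable D μ := hint'.sub hint
  have hlin : ∀ φ : ℂ → ℝ, Measurable φ → φ 0 = 0 →
      ∫⁻ x, ENNReal.ofReal (φ (D x)) ∂μ = C * ∫⁻ y, β y * ENNReal.ofReal (φ (W y)) ∂νG := by
    intro φ hφm hφ0
    obtain ⟨hψm, hψB⟩ := hpart φ hφm hφ0
    rw [← hunf β hβ _ hψm hψB]
    refine lintegral_congr fun x => ?_
    rw [hDW x, hW]
    exact ofReal_comp_pseudoEisenstein_classWindow_eq_tsum_two hK hT hTT' φ hφ0 _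
  -- finiteness: `C ∫⁻ β ψφ = ∫⁻_X ofReal (φ D) ≤ ∫⁻_X ‖D‖ₑ < ∞`, and `C ≠ 0`
  have hfin : ∀ φ : ℂ → ℝ, Measurable φ → φ 0 = 0 → (∀ z : ℂ, φ z ≤ ‖z‖) →
      ∫⁻ y, β y * ENNReal.ofReal (φ (W y)) ∂νG ≠ ⊤ := by
    intro φ hφm hφ0 hφle
    have hle : C * ∫⁻ y, β y * ENNReal.ofReal (φ (W y)) ∂νG ≤ ∫⁻ x, ‖D x‖ₑ ∂μ := by
      rw [← hlin φ hφm hφ0]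
      refine lintegral_mono fun x => ?_
      rw [← ofReal_norm]
      exact ENNReal.ofReal_le_ofReal (hφle _)
    exact (ENNReal.lt_top_of_mul_ne_top_right (ne_top_of_le_ne_top hDint.2.ne hle) hC0).ne
  -- the four `φ`
  have hre0 : (fun z : ℂ => z.re) 0 = 0 := Complex.zero_re
  have hnre0 : (fun z : ℂ => -z.re) 0 = 0 := by simp
  have him0 : (fun z : ℂ => z.im) 0 = 0 := Complex.zero_im
  have hnim0 : (fun z : ℂ => -z.im) 0 = 0 := by simp
  have hrem : Measurable fun z : ℂ => z.re := Complex.measurable_re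
  have hnrem : Measurable fun z : ℂ => -z.re := Complex.measurable_re.neg
  have himm : Measurable fun z : ℂ => z.im := Complex.measurable_im
  have hnimm : Measurable fun z : ℂ => -z.im := Complex.measurable_im.neg
  have hrele : ∀ z : ℂ, (fun z : ℂ => z.re) z ≤ ‖z‖ := fun z => Complex.re_le_norm z
  have hnrele : ∀ z : ℂ, (fun z : ℂ => -z.re) z ≤ ‖z‖ := fun z =>
    (neg_le_abs _).trans (Complex.abs_re_le_norm z)
  have himle : ∀ z : ℂ, (fun z : ℂ => z.im) z ≤ ‖z‖ := fun z => Complex.im_le_norm z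
  have hnimle : ∀ z : ℂ, (fun z : ℂ => -z.im) z ≤ ‖z‖ := fun z =>
    (neg_le_abs _).trans (Complex.abs_im_le_norm z)
  refine ⟨⟨hfin _ hrem hre0 hrele, hfin _ hnrem hnre0 hnrele, hfin _ himm him0 himle,
    hfin _ hnimm hnim0 hnimle⟩, ?_⟩
  -- the Bochner side
  have hsub : truncatedTraceClass μ ν 𝓕 T' cl i f - truncatedTraceClass μ ν 𝓕 T cl i f = ∫ x, D x ∂μ := by
    rw [truncatedTraceClass_def, truncatedTraceClass_def, ← integral_sub hint' hint]
  have hreint : ∫ x, (D x).re ∂μ =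
      (C * ∫⁻ y, β y * ENNReal.ofReal (W y).re ∂νG).toReal -
        (C * ∫⁻ y, β y * ENNReal.ofReal (-(W y).re) ∂νG).toReal := by
    have h := integral_eq_lintegral_pos_part_sub_lintegral_neg_part hDint.re
    simp only [RCLike.re_to_complex] at h
    rw [h]
    change (∫⁻ x, ENNReal.ofReal ((fun z : ℂ => z.re) (D x)) ∂μ).toReal -
        (∫⁻ x, ENNReal.ofReal ((fun z : ℂ => -z.re) (D x)) ∂μ).toReal = _
    rw [hlin _ hrem hre0, hlin _ hnrem hnre0]
  have himint : ∫ x, (D x).im ∂μ =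
      (C * ∫⁻ y, β y * ENNReal.ofReal (W y).im ∂νG).toReal -
        (C * ∫⁻ y, β y * ENNReal.ofReal (-(W y).im) ∂νG).toReal := by
    have h := integral_eq_lintegral_pos_part_sub_lintegral_neg_part hDint.im
    simp only [RCLike.im_to_complex] at h
    rw [h]
    change (∫⁻ x, ENNReal.ofReal ((fun z : ℂ => z.im) (D x)) ∂μ).toReal -
        (∫⁻ x, ENNReal.ofReal ((fun z : ℂ => -z.im) (D x)) ∂μ).toReal = _
    rw [hlin _ himm him0, hlin _ hnimm hnim0]
  rw [hsub, ← integral_re_add_im hDint]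
  simp only [RCLike.re_to_complex, RCLike.im_to_complex, RCLike.I_to_complex]
  rw [hreint, himint]
  rfl

/-- **The fixed-class form** of ★ `exists_truncatedTraceClass_sub_eq_parts_two` (the identity alone, `cl` and `i`
first, `𝓕` and `β` explicit) — the shape in which the per-class polynomiality assembly consumes it.
[cite: Rogawski1990, §2.3 (p. 14)] [cite: Arthur1981TraceFormulaInvariantForm, Prop. 2.3] -/
theorem exists_truncatedTraceClass_sub_eq_parts_two' {cl : (quasiSplit F E c 2).arithmeticSubgroup → ι}
    (hcl : IsConjInvariant cl) (hclN : IsUnipotentInvariantOnBorel F E c 2 cl) (i : ι)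
    (ν : Measure (adelicUnipotent F E c 2)) [ν.IsHaarMeasure] (𝓕 : Set (adelicUnipotent F E c 2))
    (h𝓕 : IsFundamentalDomain (rationalUnipotent F E c 2) 𝓕 ν)
    (μ : Measure (quasiSplit F E c 2).automorphicQuotient) [(quasiSplit F E c 2).IsAutomorphicMeasure μ]
    (νG : Measure (quasiSplit F E c 2).Adelic) [νG.IsHaarMeasure] [νG.IsInvInvariant]
    (f : (quasiSplit F E c 2).Adelic → ℂ) (hfc : Continuous f)
    (β : (quasiSplit F E c 2).Adelic → ℝ≥0∞)
    (hβ : IsCoveringWeight ((arithmeticBorel F E c 2).map (quasiSplit F E c 2).arithmeticSubgroup.subtype) β) :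
    ∃ C : ℝ≥0∞, C ≠ ⊤ ∧ ∀ T T' : ℝ≥0, 1 ≤ T → T ≤ T' →
      Integrable ((quasiSplit F E c 2).quotFun (truncatedKernelClass ν 𝓕 T cl i f)) μ →
      Integrable ((quasiSplit F E c 2).quotFun (truncatedKernelClass ν 𝓕 T' cl i f)) μ →
      truncatedTraceClass μ ν 𝓕 T' cl i f - truncatedTraceClass μ ν 𝓕 T cl i f =
        (((C * ∫⁻ y, β y * ENNReal.ofReal
            ({y : (quasiSplit F E c 2).Adelic | T < borelHeight y ∧ borelHeight y ≤ T'}.indicator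
              (fun y => kernelBorelClass ν 𝓕 cl i f y y) y).re ∂νG).toReal -
          (C * ∫⁻ y, β y * ENNReal.ofReal
            (-({y : (quasiSplit F E c 2).Adelic | T < borelHeight y ∧ borelHeight y ≤ T'}.indicator
              (fun y => kernelBorelClass ν 𝓕 cl i f y y) y).re) ∂νG).toReal : ℝ) : ℂ) +
        (((C * ∫⁻ y, β y * ENNReal.ofReal
            ({y : (quasiSplit F E c 2).Adelic | T < borelHeight y ∧ borelHeight y ≤ T'}.indicator
              (fun y => kernelBorelClass ν 𝓕 cl i f y y) y).im ∂νG).toReal -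
          (C * ∫⁻ y, β y * ENNReal.ofReal
            (-({y : (quasiSplit F E c 2).Adelic | T < borelHeight y ∧ borelHeight y ≤ T'}.indicator
              (fun y => kernelBorelClass ν 𝓕 cl i f y y) y).im) ∂νG).toReal : ℝ) : ℂ) * Complex.I := by
  obtain ⟨C, hC, h⟩ := exists_truncatedTraceClass_sub_eq_parts_two ν h𝓕 μ νG f hfc hcl hclN hβ
  exact ⟨C, hC, fun T T' hT hTT' hint hint' => (h i T T' hT hTT' hint hint').2⟩

end Bridge

end UnitaryGroup

end Literature.NumberTheory.Automorphic
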